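import Summits.QuantumFields.YangMills.Theorems.BalabanUVNodesN15KingModelThm33AtRegularField
import Literature.MathematicalPhysics.QuantumFieldTheory.Balaban1983to89.B1Ineq226HolderRegularRegion
import Literature.MathematicalPhysics.QuantumFieldTheory.Balaban1983to89.B1Ineq226RegularRegionSum
import Literature.MathematicalPhysics.QuantumFieldTheory.Balaban1983to89.B1Ineq238RegularRegionSmall

/-!
# Route «BalabanUVNodes», node N15 = NE2 — THE KING-MODEL RUNG, PART Θ⁺⁺-a: THE DATUM OF KING 1986 THEOREM 3.3 **AT A REGULAR
# BACKGROUND `A ≠ 0` ON A BIG-BLOCK REGION `Ω ⊊ T_ε` WITH THE `δ`-OPERATORS LIVE** (observation points and sources on the `R₀`-interior of `Ω`) —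
# region geometry and dictionary; the theorem BY NAME is assembled in PARTS Θ⁺⁺-b∕c∕d (`…RegionUnit`, `…RegionFine`, `…Region`)

Cell `pub-ymgap`, Track A (D-0062), seat `pub-ymgap-dag-n15-e` (R141 (C), s3), generation 21; sequel of PART Θ⁺ (`…N15KingModelThm33AtRegularField`,
p676497: `Ω = T_ε`, `δ`-clauses vacuous).  `bears_on: R4∕N15`; `--supports stmt-QuantumFields-27366` (K3⁸, `--as helper`).  COUNT-NEUTRAL.
Namespace `Summit.QuantumFields.YangMills.BalabanUVNodes.N15KingModelRung.Curved`.

THE PRINT.  [King1986] Theorem 3.3 pp. 655–656 (verbatim in `ContinuumLimit.Thm33Printed`): *«… Finally, define δC^{(k)}(Ω, A) = C^{(k)}(Ω, A) −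
C^{(k)}(A) and δG_k(Ω, A) = G_k(Ω, A) − G_k(A); then for x, y ∈ Ω_η, δC^{(k)}(Ω, A) and δG_k(Ω, A) satisfy the bounds (3.6) and (3.7)–(3.8) respectively,
with the additional factors exp[−δ₀ dist({x, y}, ∂Ω)] and exp[−δ₀ dist({x, y}, ∂Ω) − δ₀ dist(supp f, ∂Ω)] respectively on the right-hand sides.
Theorem 3.3 is proved in [Ba 4].»*  [Ba1] = [Balaban1982Higgs1] Prop. 2.1 (2.24)–(2.26) p. 610 *«for x, x′ ∈ Ω and satisfying the condition
dist({x, x′}, Ωᶜ) ≧ R₀»*, Prop. 2.2 (2.27) p. 611, Prop. 2.3 (2.34)–(2.38) pp. 611–612; [Ba4] = [Balaban1983RegularityDecay] Theorem p. 573.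

WHAT THIS FILE PROVES (0 `sorry`; the `def`s are dictionary plumbing for the King schema, no `Prop`-valued fact).
* §1 geometry of a big-block region `Ω ⊂ T_ε` on the (Higgs)₂,₃ carrier: `unitRegion k Ω = Ω^{(k)}` (the image of `Ω` in `T^{(k)}`), the [Ba1]∕[Ba4]
  interior radius `intRad = 2r_S + 2M(d+1) + 1` (fine steps; the tree's `R₀` of `B1Ineq226RegularRegion`), the `R₀`-INTERIOR SITES `IntSite k K₀ Ω` and the
  unit sites `USite k Ω`; extension by zero `extI`, the distances `sdistI` (`dist(x, supp f)`), `bdistΩ` (`dist(x, Ωᶜ)`), `sbdistI` (`dist(supp f, Ωᶜ)`) with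
  their comparison lemmas; `mem_iff_blockIter_mem_unitRegion` (`x ∈ Ω ⟺ x_k ∈ Ω^{(k)}` for a big-block union), `unitRegion_blockOf_sat` (`Ω^{(k)}` is a
  union of `L`-blocks when `L ∣ K₀`), the one-piece region tower `regTower Ω` with `pieceF_regTower` (`= Ω`).
* §2 ★ **`kingThm33DataOn C P k Ω V A a m²`** : `Thm33Data P.d (USite k Ω) (VSite V) (EuclideanSpace ℝ (Fin N))` — THE DATUM OF THEOREM 3.3 ON THE
  REGION `Ω` AT THE FIELD `A` WITH FINE CARRIER `V` (here `V = intSet k K₀ Ω`, the `R₀`-interior; sources `f : V → ℝ^N` extended by zero): the Θ⁺ dictionary (distances in lattice ∕ `η`-units, `supNorm = ‖·‖_∞`, `U(A(Γ_{y,x}))` along Θ⁺'s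
  `contourK`, `|X(x,y)|` = `ℓ¹` block norm) for the REGION operators `G_k(Ω, A) = (L^kε)^{−2}G^ε_k(Ω, A)` (`propagatorK C Ω …` on sources cut to `Ω`),
  `Δ^{(k)}(Ω, A) = (L^kε)²Δ^{(k),L^kε}(Ω, A)` (`deltaKA C Ω …`), `C^{(k)}(Ω, A) = (L^kε)^{−2}C^{(k),L^kε}_{Ω^{(k)}}(Ω, A)` (`condCov232 C Ω … Ω^{(k)}`), and
  the LIVE `δ`-operators `δG_k(Ω, A) = G_k(Ω, A) − G_k(T, A)`, `δC^{(k)}(Ω, A) = C^{(k)}(Ω, A) − C^{(k)}(T, A)` with the boundary distances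
  `dist({x,y}, ∂Ω)` (`bdistΩ`, in `η`-units on `Ω_η`; `B1Ineq234Concrete.distC Ω^{(k)}` on `Ω^{(k)}`) and `dist(supp f, ∂Ω)` (`sbdistI`).
* §3 small real-analysis helpers shared by PARTS Θ⁺⁺-b∕c (exponential weights, `(L^kε)^{±2}` bookkeeping, subadditivity of the block norm).
  The nine printed bounds — (3.6) and the live `δC` clause (PART Θ⁺⁺-b `region_unit_clauses`), (3.7)–(3.8) and the live `δG` clauses (PART Θ⁺⁺-c
  `region_fine_clauses`) — and ★★★ `thm33Printed_king_regularField_region` (PART Θ⁺⁺-d) import this file; sources listed there.  Nothing re-proved.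

HONEST FRAMING ∕ SCOPE.  (i) A KNIT; no estimate is new.  (ii) THE `R₀`-INTERIOR READING: the fine-site type of the datum is the set of sites of `Ω` at
distance `≥ R₀ = 2r_S + 2M(d+1) + 1` (fine steps) from `Ωᶜ`, and sources `f` live on it — this is [Ba1]∕[Ba4]'s printed restriction *«for x, x′ ∈ Ω and
satisfying the condition dist({x, x′}, Ωᶜ) ≥ R₀»* for GENERAL big-block regions; King states Theorem 3.3 for PARALLELEPIPEDS, where [Ba4] waives the
restriction — that waiver is NOT used here (the tree has it for (2.24)–(2.25) on boxes, `B1Ineq224∕225RegularBox`, not for (2.26)), so near `∂Ω` this file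
says nothing; the interior is nonempty only when `Ω` contains a ball of radius `R₀` (≳ `4(d+1)+3` big blocks across) — for thinner regions the
fine-lattice clauses are vacuous, while the unit-lattice clauses ((3.6), `δC`) are stated on ALL of `Ω^{(k)}` and are never vacuous for `Ω ≠ ∅`.  (iii) `Ω` a union of big blocks (`K₀L^k`-cubes) with `L ∣ K₀` (so `Ω^{(k)}` is a union of `L`-blocks, r14's (2.34) hypothesis); cubic tori of
r14's sub-family; `L` odd `≥ 3`; `m² > 0`; `1 ≤ k < K_P`; `L^kε ≤ 1`; constants existential per `K₀`.  (iv) `Ω = T_ε` is allowed (then this is PART Θ⁺ again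
with interior = everything).  NOT Bałaban's non-abelian `G(U)` of [B9]; NE2⁺ NOT printed ∕ not proved; NOT a node discharge; counts untouched; nothing
continuum ∕ ℝ⁴ ∕ OS ∕ mass-gap ∕ Clay.
-/

noncomputable section

open scoped BigOperators

namespace Summit.QuantumFields.YangMills.BalabanUVNodes.N15KingModelRung.Curved

open Literature.MathematicalPhysics.QuantumFieldTheory.Balaban1983to89
open Literature.MathematicalPhysics.QuantumFieldTheory.Balaban1983to89.HiggsLattice (ChargeData covDeriv)
open Literature.MathematicalPhysics.QuantumFieldTheory.Balaban1983to89.HiggsAveraging (blockIter)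
open Literature.MathematicalPhysics.QuantumFieldTheory.Balaban1983to89.HiggsCovariance (propagatorK)
open Literature.MathematicalPhysics.QuantumFieldTheory.Balaban1983to89.HiggsCondCov232 (condCov232 deltaCov235 condCov232_univ)
open Literature.MathematicalPhysics.QuantumFieldTheory.Balaban1983to89.B1Eq230FluctCov (mat Ix deltaKA fluctCovA)
open Literature.MathematicalPhysics.QuantumFieldTheory.Balaban1983to89.B1TorusChainTransport (IsTChain hol)
open Literature.MathematicalPhysics.QuantumFieldTheory.Balaban1983to89.B4GaugeCovariance (pathEnd)
open Literature.MathematicalPhysics.QuantumFieldTheory.Balaban1983to89.B3Ineq211RegularTorus (IsAdm one_le_tdist_of_ne')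
open Literature.MathematicalPhysics.QuantumFieldTheory.Balaban1983to89.B1Eq211ZeroFieldTorus (Shape)
open Literature.MathematicalPhysics.QuantumFieldTheory.Balaban1983to89.B1TorusCubeCover (half)
open Literature.MathematicalPhysics.QuantumFieldTheory.Balaban1983to89.B1TorusCubeLocality26 (rS)
open Literature.MathematicalPhysics.QuantumFieldTheory.Balaban1983to89.B1TorusRegionHSizes (IsBigBlockUnion isBigBlockUnion_univ)
open Literature.MathematicalPhysics.QuantumFieldTheory.Balaban1983to89.B1TorusRegionRop (chi chi_smul_apply)
open Literature.MathematicalPhysics.QuantumFieldTheory.Balaban1983to89.B1Ineq234Concrete (distC distC_nonneg distC_le val_blockIter_all val_blockOf_all)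
open Literature.MathematicalPhysics.QuantumFieldTheory.Balaban1983to89.B1Eq353SupNorm (card_blockK)
open Literature.MathematicalPhysics.QuantumFieldTheory.Balaban1983to89.HiggsAveraging (blockK mem_blockK)
open Literature.MathematicalPhysics.QuantumFieldTheory.Balaban1983to89.B2Eq337ScalarIntegration (Regions)
open Literature.MathematicalPhysics.QuantumFieldTheory.Balaban1983to89.B2Eq328ConcretePieces (pieceF)
open Literature.MathematicalPhysics.QuantumFieldTheory.Balaban1983to89.B2Prop31ZeroFieldConcrete (mem_pieceF_iff)
open Literature.MathematicalPhysics.QuantumFieldTheory.King1986.ContinuumLimit (Thm33Data Thm33Printed)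

variable {N : ℕ}

/-! ## §1 Geometry of a big-block region `Ω ⊂ T_ε` -/

section Region

variable {P : HiggsLattice.Params}

/-- `Ω^{(k)} ⊂ T^{(k)}`: the unit-lattice sites of the region, the image of `Ω` under `x ↦ x_k` (`Ω = B^k(Ω^{(k)})` for a big-block union,
`mem_iff_blockIter_mem_unitRegion`). [cite: King1986, Thm 3.3 p.655 «Ω^{(k)} ⊂ T₁^{(k)} … a union of large blocks»] [cite: Balaban1982Higgs1, Prop. 2.1 p.610 «Ω = B^k(Ω^{(k)})»] -/
def unitRegion (k : ℕ) (Ω : Finset (HiggsLattice.Site P 0)) : Finset (HiggsLattice.Site P k) := Ω.image (blockIter k)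

/-- THE INTERIOR RADIUS `R₀ = 2r_S + 2M(d+1) + 1` (fine steps) of the tree's region theorems ([Ba1] Prop. 2.1 «dist({x, x′}, Ωᶜ) ≥ R₀»).
[cite: Balaban1982Higgs1, Prop. 2.1 p.610 «R₀»] [cite: Balaban1983RegularityDecay, (2.19) p.578] -/
def intRad (P : HiggsLattice.Params) (k K₀ : ℕ) : ℕ := 2 * rS P k K₀ + 2 * half P k K₀ * (P.d + 1) + 1

open Classical in
/-- THE `R₀`-INTERIOR OF `Ω`: the fine sites `x` whose `R₀`-ball `{y : |x − y| ≤ R₀}` lies in `Ω` (as a finite set).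
[cite: Balaban1982Higgs1, Prop. 2.1 p.610 «dist(x, Ωᶜ) ≧ R₀»] -/
def intSet (k K₀ : ℕ) (Ω : Finset (HiggsLattice.Site P 0)) : Finset (HiggsLattice.Site P 0) :=
  Finset.univ.filter fun x => ∀ y, HiggsLattice.Site.tdist x y ≤ intRad P k K₀ → y ∈ Ω

/-- membership in the interior set is the interior property. [cite: Balaban1982Higgs1, Prop. 2.1 p.610] -/
theorem mem_intSet {k K₀ : ℕ} {Ω : Finset (HiggsLattice.Site P 0)} {x : HiggsLattice.Site P 0} :
    x ∈ intSet k K₀ Ω ↔ ∀ y, HiggsLattice.Site.tdist x y ≤ intRad P k K₀ → y ∈ Ω := by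
  classical
  unfold intSet; simp

/-- THE FINE SITES OF THE DATUM: the `R₀`-interior of `Ω` (a subtype of `T_ε`). [cite: Balaban1982Higgs1, Prop. 2.1 p.610] -/
abbrev IntSite (k K₀ : ℕ) (Ω : Finset (HiggsLattice.Site P 0)) : Type := {x : HiggsLattice.Site P 0 // x ∈ intSet k K₀ Ω}

/-- THE FINE SITES OF A DATUM ON A GENERAL CARRIER `V ⊆ T_ε` (a subtype; `V` = the `R₀`-interior in PART Θ⁺⁺). [cite: King1986, Thm 3.3 p.655 «Ω_η»] -/
abbrev VSite (V : Finset (HiggsLattice.Site P 0)) : Type := {x : HiggsLattice.Site P 0 // x ∈ V}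

/-- an interior site has the interior property. [cite: Balaban1982Higgs1, Prop. 2.1 p.610] -/
theorem IntSite.isInt {k K₀ : ℕ} {Ω : Finset (HiggsLattice.Site P 0)} (x : IntSite k K₀ Ω) :
    ∀ y, HiggsLattice.Site.tdist x.1 y ≤ intRad P k K₀ → y ∈ Ω := mem_intSet.1 x.2

/-- THE UNIT SITES OF THE DATUM: `Ω^{(k)}` (a subtype of `T^{(k)}`). [cite: King1986, Thm 3.3 p.655] -/
abbrev USite (k : ℕ) (Ω : Finset (HiggsLattice.Site P 0)) : Type := {y : HiggsLattice.Site P k // y ∈ unitRegion k Ω}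

/-- An interior site lies in `Ω`. [cite: Balaban1982Higgs1, Prop. 2.1 p.610] -/
theorem IntSite.mem {k K₀ : ℕ} {Ω : Finset (HiggsLattice.Site P 0)} (x : IntSite k K₀ Ω) : x.1 ∈ Ω :=
  x.isInt x.1 (by rw [B1Ineq234Concrete.tdist_self]; exact Nat.zero_le _)

/-- Extension by zero of a source on the carrier `V` to the torus (King's `f : Ω_η → R^N` read on `T_ε`). [cite: King1986, Thm 3.3 (3.7) p.656] -/
def extI {V : Finset (HiggsLattice.Site P 0)} (f : VSite V → EuclideanSpace ℝ (Fin N)) : HiggsLattice.ScalarField P 0 N :=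
  fun y => if h : y ∈ V then f ⟨y, h⟩ else 0

/-- `‖(ext f)(y)‖ ≤ ‖f‖_∞`. [cite: King1986, Thm 3.3 (3.7) p.656] -/
theorem norm_extI_le {V : Finset (HiggsLattice.Site P 0)} (f : VSite V → EuclideanSpace ℝ (Fin N))
    (y : HiggsLattice.Site P 0) : ‖extI f y‖ ≤ ‖f‖ := by
  unfold extI
  split_ifs with h
  · exact norm_le_pi_norm f ⟨y, h⟩
  · rw [norm_zero]; exact norm_nonneg _

/-- where the extension is non-zero the point is in the carrier and `f` is non-zero there. [cite: King1986, Thm 3.3 (3.7) p.656] -/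
theorem extI_ne_zero {V : Finset (HiggsLattice.Site P 0)} {f : VSite V → EuclideanSpace ℝ (Fin N)}
    {y : HiggsLattice.Site P 0} (h : extI f y ≠ 0) : ∃ hy : y ∈ V, f ⟨y, hy⟩ ≠ 0 := by
  unfold extI at h
  split_ifs at h with hy
  · exact ⟨hy, h⟩
  · exact absurd rfl h

/-- a cut-off source is non-zero only where the source is. [cite: Balaban1982Higgs1, Prop. 2.1 p.610] -/
theorem ne_zero_of_chi_smul_ne_zero {Ω : Finset (HiggsLattice.Site P 0)} {g : HiggsLattice.ScalarField P 0 N} {y : HiggsLattice.Site P 0}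
    (h : (chi Ω • g) y ≠ 0) : g y ≠ 0 := by
  rw [chi_smul_apply] at h
  split_ifs at h with hy
  · exact h
  · exact absurd rfl h

open Classical in
/-- `dist(x, supp f)` in fine steps for a source on the interior (`0` for `f = 0`). [cite: King1986, Thm 3.3 (3.7) p.656] -/
def sdistI {V : Finset (HiggsLattice.Site P 0)} (x : VSite V) (f : VSite V → EuclideanSpace ℝ (Fin N)) : ℝ :=
  if h : (Finset.univ.filter fun z : VSite V => f z ≠ 0).Nonempty then
    (((Finset.univ.filter fun z : VSite V => f z ≠ 0).inf' h fun z => HiggsLattice.Site.tdist x.1 z.1 : ℕ) : ℝ) else 0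

/-- `dist(x, supp f) ≤ |x − z|` at a point of the support. [cite: King1986, Thm 3.3 (3.7) p.656] -/
theorem sdistI_le {V : Finset (HiggsLattice.Site P 0)} {x z : VSite V} {f : VSite V → EuclideanSpace ℝ (Fin N)}
    (hz : f z ≠ 0) : sdistI x f ≤ (HiggsLattice.Site.tdist x.1 z.1 : ℝ) := by
  classical
  have hmem : z ∈ Finset.univ.filter fun z : VSite V => f z ≠ 0 := Finset.mem_filter.2 ⟨Finset.mem_univ _, hz⟩
  unfold sdistI
  rw [dif_pos ⟨z, hmem⟩]
  exact_mod_cast Finset.inf'_le _ hmem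

/-- `dist(x, supp f) ≥ 0`. [cite: King1986, Thm 3.3 (3.7) p.656] -/
theorem sdistI_nonneg {V : Finset (HiggsLattice.Site P 0)} (x : VSite V) (f : VSite V → EuclideanSpace ℝ (Fin N)) :
    0 ≤ sdistI x f := by
  unfold sdistI; split_ifs <;> positivity

open Classical in
/-- `dist(x, Ωᶜ)` in fine steps (`0` when `Ω = T_ε`). [cite: King1986, Thm 3.3 p.656 «dist({x, y}, ∂Ω)»] -/
def bdistΩ (Ω : Finset (HiggsLattice.Site P 0)) (x : HiggsLattice.Site P 0) : ℝ :=
  if h : (Ωᶜ).Nonempty then (((Ωᶜ).inf' h fun w => HiggsLattice.Site.tdist x w : ℕ) : ℝ) else 0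

/-- `dist(x, Ωᶜ) ≤ |x − w|` for `w ∉ Ω`. [cite: King1986, Thm 3.3 p.656] -/
theorem bdistΩ_le {Ω : Finset (HiggsLattice.Site P 0)} (x : HiggsLattice.Site P 0) {w : HiggsLattice.Site P 0} (hw : w ∉ Ω) :
    bdistΩ Ω x ≤ (HiggsLattice.Site.tdist x w : ℝ) := by
  classical
  have hmem : w ∈ Ωᶜ := Finset.mem_compl.2 hw
  unfold bdistΩ
  rw [dif_pos ⟨w, hmem⟩]
  exact_mod_cast Finset.inf'_le _ hmem

/-- `dist(x, Ωᶜ) ≥ 0`. [cite: King1986, Thm 3.3 p.656] -/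
theorem bdistΩ_nonneg (Ω : Finset (HiggsLattice.Site P 0)) (x : HiggsLattice.Site P 0) : 0 ≤ bdistΩ Ω x := by
  unfold bdistΩ; split_ifs <;> positivity

open Classical in
/-- `dist(supp f, Ωᶜ)` in fine steps (`0` for `f = 0`). [cite: King1986, Thm 3.3 p.656 «dist(supp f, ∂Ω)»] -/
def sbdistI (Ω : Finset (HiggsLattice.Site P 0)) {V : Finset (HiggsLattice.Site P 0)} (f : VSite V → EuclideanSpace ℝ (Fin N)) : ℝ :=
  if h : (Finset.univ.filter fun z : VSite V => f z ≠ 0).Nonempty then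
    (Finset.univ.filter fun z : VSite V => f z ≠ 0).inf' h fun z => bdistΩ Ω z.1 else 0

/-- `dist(supp f, Ωᶜ) ≤ |z − w|` for `z ∈ supp f`, `w ∉ Ω`. [cite: King1986, Thm 3.3 p.656] -/
theorem sbdistI_le {Ω V : Finset (HiggsLattice.Site P 0)} {f : VSite V → EuclideanSpace ℝ (Fin N)} {z : VSite V}
    (hz : f z ≠ 0) {w : HiggsLattice.Site P 0} (hw : w ∉ Ω) : sbdistI Ω f ≤ (HiggsLattice.Site.tdist w z.1 : ℝ) := by
  classical
  have hmem : z ∈ Finset.univ.filter fun z : VSite V => f z ≠ 0 := Finset.mem_filter.2 ⟨Finset.mem_univ _, hz⟩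
  unfold sbdistI
  rw [dif_pos ⟨z, hmem⟩, tdist_comm w z.1]
  exact (Finset.inf'_le _ hmem).trans (bdistΩ_le z.1 hw)

/-- `dist(supp f, Ωᶜ) ≥ 0`. [cite: King1986, Thm 3.3 p.656] -/
theorem sbdistI_nonneg (Ω : Finset (HiggsLattice.Site P 0)) {V : Finset (HiggsLattice.Site P 0)} (f : VSite V → EuclideanSpace ℝ (Fin N)) :
    0 ≤ sbdistI Ω f := by
  unfold sbdistI
  split_ifs with h
  · exact Finset.le_inf' _ _ fun z _ => bdistΩ_nonneg Ω z.1
  · exact le_rfl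

/-- Two fine sites have the same `k`-block iff their labels agree after division by `L^k`. [cite: Balaban1982Higgs1, (1.20) p.607] -/
theorem blockIter_eq_iff_div (k : ℕ) (x x' : HiggsLattice.Site P 0) :
    blockIter k x = blockIter k x' ↔ ∀ μ, (x μ).val / P.L ^ k = (x' μ).val / P.L ^ k := by
  constructor
  · intro h μ
    rw [← val_blockIter_all k x μ, ← val_blockIter_all k x' μ, h]
  · intro h
    funext μ
    apply ZMod.val_injective
    rw [val_blockIter_all, val_blockIter_all, h μ]

/-- **`x ∈ Ω ⟺ x_k ∈ Ω^{(k)}`** for a union `Ω` of big blocks (`K₀L^k`-cubes): `Ω = B^k(Ω^{(k)})`. [cite: Balaban1982Higgs1, Prop. 2.1 p.610 «Ω = B^k(Ω^{(k)})»] -/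
theorem mem_iff_blockIter_mem_unitRegion {k K₀ : ℕ} {Ω : Finset (HiggsLattice.Site P 0)} (hΩ : IsBigBlockUnion k K₀ Ω)
    (x : HiggsLattice.Site P 0) : x ∈ Ω ↔ blockIter k x ∈ unitRegion k Ω := by
  constructor
  · intro hx; exact Finset.mem_image_of_mem _ hx
  · intro hx
    obtain ⟨x₀, hx₀, he⟩ := Finset.mem_image.1 hx
    have hd := (blockIter_eq_iff_div k x₀ x).1 he
    have hbig : ∀ μ, (x₀ μ).val / half P k K₀ = (x μ).val / half P k K₀ := fun μ => by
      unfold half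
      rw [← Nat.div_div_eq_div_mul, ← Nat.div_div_eq_div_mul, hd μ]
    exact (hΩ x₀ x hbig).1 hx₀

/-- `Ω^{(k)}` IS A UNION OF `L`-BLOCKS of `T^{(k+1)}` when `L ∣ K₀` (`k < K_P`; every unit site has a fine site above it, `card_blockK`).
[cite: Balaban1982Higgs1, Prop. 2.3 p.611 «Λ is a union of big blocks of T₁^{(k)}»] -/
theorem unitRegion_blockOf_sat {k K₀ : ℕ} (hk : k ≤ P.K) (hLK : P.L ∣ K₀) {Ω : Finset (HiggsLattice.Site P 0)} (hΩ : IsBigBlockUnion k K₀ Ω)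
    (y y' : HiggsLattice.Site P k) (hyy : HiggsLattice.blockOf y = HiggsLattice.blockOf y') :
    y ∈ unitRegion k Ω ↔ y' ∈ unitRegion k Ω := by
  obtain ⟨K₁, hK₁⟩ := hLK
  -- a fine point above each of `y`, `y′`
  have hsurj : ∀ z : HiggsLattice.Site P k, ∃ x : HiggsLattice.Site P 0, blockIter k x = z := fun z => by
    have hc : 0 < (blockK k z).card := by rw [card_blockK hk]; exact pow_pos P.hL _
    obtain ⟨x, hx⟩ := Finset.card_pos.1 hc
    exact ⟨x, (mem_blockK k z x).1 hx⟩
  -- two fine points over `L`-equivalent unit sites share a big block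
  have key : ∀ x x' : HiggsLattice.Site P 0, HiggsLattice.blockOf (blockIter k x) = HiggsLattice.blockOf (blockIter k x') →
      (x ∈ Ω ↔ x' ∈ Ω) := by
    intro x x' h
    apply hΩ x x'
    intro μ
    have h1 := congrArg (fun z : HiggsLattice.Site P (k + 1) => (z μ).val) h
    simp only [val_blockOf_all, val_blockIter_all, Nat.div_div_eq_div_mul] at h1
    unfold half
    rw [hK₁, show P.L ^ k * (P.L * K₁) = P.L ^ k * P.L * K₁ by ring, ← Nat.div_div_eq_div_mul, ← Nat.div_div_eq_div_mul (x' μ).val, h1]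
  constructor
  · intro hy
    obtain ⟨x₀, hx₀, he⟩ := Finset.mem_image.1 hy
    obtain ⟨x', hx'⟩ := hsurj y'
    have : x' ∈ Ω := (key x₀ x' (by rw [he, hx', hyy])).1 hx₀
    exact Finset.mem_image.2 ⟨x', this, hx'⟩
  · intro hy'
    obtain ⟨x₀, hx₀, he⟩ := Finset.mem_image.1 hy'
    obtain ⟨x', hx'⟩ := hsurj y
    have : x' ∈ Ω := (key x₀ x' (by rw [he, hx', hyy])).1 hx₀
    exact Finset.mem_image.2 ⟨x', this, hx'⟩

/-- THE ONE-PIECE REGION TOWER of r14's (2.34)∕(2.38) engine: at every level the unit region of `Ω`; its top piece is `Ω` (`pieceF_regTower`).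
[cite: Balaban1982Higgs1, Prop. 2.3 (2.32) p.611] -/
def regTower {j : ℕ} (Ω : Finset (HiggsLattice.Site P 0)) : Regions P (j + 1) where
  inner := ∅
  block := fun i => unitRegion (i.val + 1) Ω

/-- The top piece of the tower is `Ω` itself (for a big-block union). [cite: Balaban1982Higgs1, Prop. 2.1 p.610 «Ω = B^k(Ω^{(k)})»] -/
theorem pieceF_regTower {j K₀ : ℕ} {Ω : Finset (HiggsLattice.Site P 0)} (hΩ : IsBigBlockUnion (j + 1) K₀ Ω) :
    pieceF (regTower (j := j) Ω) (Fin.last j) = Ω := by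
  ext x
  rw [mem_pieceF_iff, mem_iff_blockIter_mem_unitRegion hΩ]
  rfl

end Region

/-! ## §2 The datum of Theorem 3.3 on a region -/

/-- ★ **THE DATUM OF KING's THEOREM 3.3 ON A BIG-BLOCK REGION `Ω ⊂ T_ε` AT THE FIELD `A`, LEVEL `k`, WITH FINE CARRIER `V ⊆ Ω`** (observation
points and sources on `V`; `V` = the `R₀`-interior `intSet k K₀ Ω` in PART Θ⁺⁺; dictionary in the module docstring §2).
[cite: King1986, Thm 3.3 (3.6)–(3.8) pp.655–656] [cite: Balaban1982Higgs1, (2.22), (2.26) p.610, (2.31)–(2.32), (2.37) pp.611–612] -/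
def kingThm33DataOn (C : ChargeData N) (P : HiggsLattice.Params) (k : ℕ) (Ω V : Finset (HiggsLattice.Site P 0)) (A : HiggsLattice.VecField P 0)
    (a msq : ℝ) : Thm33Data P.d (USite k Ω) (VSite V) (EuclideanSpace ℝ (Fin N)) where
  distk x y := (HiggsLattice.Site.tdist x.1 y.1 : ℝ)
  distη x y := (HiggsLattice.Site.tdist x.1 y.1 : ℝ) / (P.L : ℝ) ^ k
  dsupp f x := sdistI x f / (P.L : ℝ) ^ k
  dsupp2 f x y := min (sdistI x f) (sdistI y f) / (P.L : ℝ) ^ k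
  dbdryk x y := min (distC (unitRegion k Ω) x.1) (distC (unitRegion k Ω) y.1)
  dbdryη x y := min (bdistΩ Ω x.1) (bdistΩ Ω y.1) / (P.L : ℝ) ^ k
  dsuppbdry f := sbdistI Ω f / (P.L : ℝ) ^ k
  supNorm f := ‖f‖
  transport y x := hol C A y.1 (contourK y.1 x.1)
  lapK x y := P.mesh k ^ 2 * blockNormK (deltaKA C Ω A msq a k) x.1 y.1
  covK x y := (P.mesh k ^ 2)⁻¹ * blockNormK (condCov232 C Ω A msq a k (unitRegion k Ω)) x.1 y.1
  δcovK x y := (P.mesh k ^ 2)⁻¹ *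
    blockNormK (condCov232 C Ω A msq a k (unitRegion k Ω) - condCov232 C Finset.univ A msq a k Finset.univ) x.1 y.1
  G f := fun x => (P.mesh k ^ 2)⁻¹ • propagatorK C Ω A msq a k (chi Ω • extI f) x.1
  DG μ f := fun x => (P.mesh k)⁻¹ • covDeriv C A (propagatorK C Ω A msq a k (chi Ω • extI f)) ⟨x.1, μ⟩
  δG f := fun x => (P.mesh k ^ 2)⁻¹ •
    (propagatorK C Ω A msq a k (chi Ω • extI f) - propagatorK C Finset.univ A msq a k (chi (Finset.univ : Finset (HiggsLattice.Site P 0)) • extI f)) x.1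
  δDG μ f := fun x => (P.mesh k)⁻¹ •
    covDeriv C A (propagatorK C Ω A msq a k (chi Ω • extI f) - propagatorK C Finset.univ A msq a k (chi (Finset.univ : Finset (HiggsLattice.Site P 0)) • extI f)) ⟨x.1, μ⟩

/-! ## §3 Shared helpers for PARTS Θ⁺⁺-b∕c -/

/-- exponential weights compare (as in PART Θ⁺). [folklore] -/
theorem weight_mono_region {c c' δ δ' s M : ℝ} (hc : c ≤ c') (hc' : 0 ≤ c') (hδ : δ' ≤ δ) (hs : 0 ≤ s) (hM : 0 ≤ M) :
    c * Real.exp (-(δ * s)) * M ≤ c' * Real.exp (-(δ' * s)) * M := by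
  have h1 : Real.exp (-(δ * s)) ≤ Real.exp (-(δ' * s)) := Real.exp_le_exp.2 (neg_le_neg (mul_le_mul_of_nonneg_right hδ hs))
  have h2 : c * Real.exp (-(δ * s)) ≤ c' * Real.exp (-(δ' * s)) :=
    (mul_le_mul_of_nonneg_right hc (Real.exp_nonneg _)).trans (mul_le_mul_of_nonneg_left h1 hc')
  exact mul_le_mul_of_nonneg_right h2 hM

/-- splitting an exponential weight with a sum in the exponent against a minimum. [folklore] -/
theorem exp_sum_le_min_region {δ s u v : ℝ} (hδ : 0 ≤ δ) (hv : 0 ≤ v) :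
    Real.exp (-(δ * (s + u + v))) ≤ Real.exp (-(δ * s)) * Real.exp (-(δ * min u v)) := by
  rw [← Real.exp_add]
  apply Real.exp_le_exp.2
  have h1 : δ * min u v ≤ δ * u := mul_le_mul_of_nonneg_left (min_le_left _ _) hδ
  have h2 : 0 ≤ δ * v := mul_nonneg hδ hv
  nlinarith only [h1, h2]

/-- the block norm is subadditive in the operator (sum form). [folklore] -/
theorem blockNormK_add_le {P : HiggsLattice.Params} {k : ℕ} (S T : HiggsLattice.ScalarField P k N →ₗ[ℝ] HiggsLattice.ScalarField P k N)
    (x y : HiggsLattice.Site P k) : blockNormK (S + T) x y ≤ blockNormK S x y + blockNormK T x y := by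
  unfold blockNormK
  rw [← Finset.sum_add_distrib]
  refine Finset.sum_le_sum fun i _ => ?_
  rw [← Finset.sum_add_distrib]
  refine Finset.sum_le_sum fun i' _ => ?_
  have : mat (S + T) (x, i) (y, i') = mat S (x, i) (y, i') + mat T (x, i) (y, i') := by
    unfold mat; rw [map_add]; rfl
  rw [this]
  exact abs_add_le _ _

/-- the entries of a difference of operators. [folklore] -/
theorem mat_sub_apply {P : HiggsLattice.Params} {k : ℕ} (S T : HiggsLattice.ScalarField P k N →ₗ[ℝ] HiggsLattice.ScalarField P k N)
    (p q : HiggsLattice.Site P k × Ix N) : mat (S - T) p q = mat S p q - mat T p q := by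
  unfold mat; rw [map_sub]; rfl

/-- `(L^kε)² · X ≤ n·c·E` from `X ≤ n·((L^kε)⁻²·c·E)`. [folklore] -/
theorem meshsq_mul_le_of_le {m X n c E : ℝ} (hm : 0 < m) (h : X ≤ n * ((m)⁻¹ ^ 2 * c * E)) : m ^ 2 * X ≤ n * c * E := by
  have hm2 : m ^ 2 ≠ 0 := pow_ne_zero _ hm.ne'
  calc m ^ 2 * X ≤ m ^ 2 * (n * ((m)⁻¹ ^ 2 * c * E)) := mul_le_mul_of_nonneg_left h (sq_nonneg _)
    _ = n * c * E := by field_simp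

/-- `(L^kε)⁻² · X ≤ n·c·E` from `X ≤ n·((L^kε)²·c·E)`. [folklore] -/
theorem inv_meshsq_mul_le_of_le {m X n c E : ℝ} (hm : 0 < m) (h : X ≤ n * (m ^ 2 * c * E)) : (m ^ 2)⁻¹ * X ≤ n * c * E := by
  have hm2 : m ^ 2 ≠ 0 := pow_ne_zero _ hm.ne'
  calc (m ^ 2)⁻¹ * X ≤ (m ^ 2)⁻¹ * (n * (m ^ 2 * c * E)) := mul_le_mul_of_nonneg_left h (inv_nonneg.2 (sq_nonneg _))
    _ = n * c * E := by field_simp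

/-- `(L^kε)⁻² · X ≤ c·E·M` from `X ≤ c·(L^kε)²·E·M`. [folklore] -/
theorem inv_meshsq_mul_le_of_le' {m X c E M : ℝ} (hm : 0 < m) (h : X ≤ c * m ^ 2 * E * M) : (m ^ 2)⁻¹ * X ≤ c * E * M := by
  have hm2 : m ^ 2 ≠ 0 := pow_ne_zero _ hm.ne'
  calc (m ^ 2)⁻¹ * X ≤ (m ^ 2)⁻¹ * (c * m ^ 2 * E * M) := mul_le_mul_of_nonneg_left h (inv_nonneg.2 (sq_nonneg _))
    _ = c * E * M := by field_simp

/-- `(L^kε)⁻¹ · X ≤ c·E·M` from `X ≤ c·(L^kε)·E·M`. [folklore] -/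
theorem inv_mesh_mul_le_of_le' {m X c E M : ℝ} (hm : 0 < m) (h : X ≤ c * m * E * M) : m⁻¹ * X ≤ c * E * M := by
  have hm1 : m ≠ 0 := hm.ne'
  calc m⁻¹ * X ≤ m⁻¹ * (c * m * E * M) := mul_le_mul_of_nonneg_left h (inv_nonneg.2 hm.le)
    _ = c * E * M := by field_simp

/-- a continuous linear map through a scalar: `T(c•u) − c•v = c•(Tu − v)`. [folklore] -/
theorem clm_smul_sub {E : Type*} [NormedAddCommGroup E] [NormedSpace ℝ E] (T : E →L[ℝ] E) (c : ℝ) (u v : E) :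
    T (c • u) - c • v = c • (T u - v) := by
  rw [ContinuousLinearMap.map_smul, smul_sub]

/-- the rate bookkeeping `D∕(cK₀L^k) = (1∕(cK₀))·(D∕L^k)` inside an exponential weight. [folklore] -/
theorem exp_rate_region {c K Lk : ℝ} (hc : c ≠ 0) (hK : K ≠ 0) (hLk : Lk ≠ 0) (D : ℝ) :
    Real.exp (-(D / (c * K * Lk))) = Real.exp (-(1 / (c * K) * (D / Lk))) := by
  congr 1; field_simp

/-- splitting `exp(−r(p+q+s)) ≤ exp(−δp)·exp(−δq − δs)` for `δ ≤ r` and `p, q, s ≥ 0`. [folklore] -/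
theorem exp_split3_region {r δ p q s : ℝ} (hδ : δ ≤ r) (hp : 0 ≤ p) (hq : 0 ≤ q) (hs : 0 ≤ s) :
    Real.exp (-(r * (p + q + s))) ≤ Real.exp (-(δ * p)) * Real.exp (-(δ * q) - δ * s) := by
  rw [← Real.exp_add]
  apply Real.exp_le_exp.2
  have h1 := mul_le_mul_of_nonneg_right hδ hp
  have h2 := mul_le_mul_of_nonneg_right hδ hq
  have h3 := mul_le_mul_of_nonneg_right hδ hs
  nlinarith only [h1, h2, h3]

end Summit.QuantumFields.YangMills.BalabanUVNodes.N15KingModelRung.Curved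

end
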